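import Summits.Ventures.YMGap.RobustBall.BoundaryDecayBall
import Summits.Ventures.YMGap.RobustBall.UniformLoopCorrelatorDecay
import Summits.Ventures.YMGap.RobustBall.PeriodisedBox
import HarnessLib

/-!
# Venture YMGap, track ROBUST-BALL — ONE STATE AT A RATE for WILSON LOOPS: finite-volume Wilson-loop expectations with ANY boundary
# field approach their infinite-volume value exponentially fast in the distance of the loop to the boundary

HONEST FRAMING. WHAT THIS IS: a venture file (cell `pub-ymgap`, track Y2 ROBUST-BALL, seat ds-3, theorems only): the boundary-rate
theorems of `BoundaryDecayBall.lean` read on the observables of record, the WILSON LOOP observables `W_γ = Re tr U_γ / N` of arbitrary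
closed lattice walks `γ` (rb-p1's `loopTerm N 1 γ`), which are Lipschitz cylinders on the links of `γ` with constant `√N · |γ|`
(`isLipschitzCylinder_loopTerm`) and at most `|γ|` links (`card_walkEdges_le_length`):
* ★ `abs_boundary_loop_sub_le_of_memBallZd_su2` — `SU(2)`, every `d ≥ 1`, on the tier-1 ball `MemBallZd ε₀ ε₁ R` under
  `2(d−1)|β_W| e^{ε₀} + e^{ε₀/2} √(2/3) ε₁ ≤ ρ < 1`: for every member, every DLR state `μ`, every volume `Λ`, EVERY boundary field `η` and
  every closed walk `γ` whose links are at depth `≥ D` in `Λ`: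
  `|⟨c W_γ⟩_{Λ,η} − ⟨c W_γ⟩_μ| ≤ 4 · |c| · |γ|² · max(ρ,½)^{⌊D/max(1,R)⌋}`;
* ★★ `su2_wilson_loop_boundary_upTo_oneTwelfth` — THE WILSON POINT, `SU(2)` on `ℤ⁴`, `0 ≤ β_W ≤ 1/12`: for EVERY DLR state and every
  boundary field, `|⟨W_γ⟩_{Λ,η} − ⟨W_γ⟩_μ| ≤ 4 · |γ|² · (1/2)^{⌊D⌋}` — the finite-volume error on a Wilson loop of perimeter `|γ|` at
  distance `D` from the boundary is at most `4|γ|² 2^{−D}`; `su2_wilson_loop_box_upTo_oneTwelfth` (loop in `[−m,m]⁴`, box `[−n,n]⁴`: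
  `4|γ|² 2^{−(n−m)}`);
* ★ `suN_wilson_loop_boundary_bakryEmery` — every `N ≥ 2`, every `d ≥ 1`, Bakry–Émery window `2(d−1)|β| < 1/2` ('t Hooft `β`):
  `|⟨W_γ⟩_{Λ,η} − ⟨W_γ⟩_μ| ≤ 2N · |γ|² · ρ'^{⌊D⌋}`, `ρ' = max(ρ,½)`, `ρ ≥ 6(d−1)|β|/(1/2 − 2(d−1)|β|)`.
WHAT THIS IS NOT: Dobrushin-comparison lower bounds on the rate inside the single-link doors; lattice strong coupling; nothing about the
continuum limit, the area law at weak coupling, or the Clay Millennium problem.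

References: H. Föllmer, LNM 1362 (1988), Ch. I, (2.8)/(2.10); rb-p1's `LoopObservable.lean`, `UniformLoopCorrelatorDecay.lean`
(`isLipschitzCylinder_loopTerm`); the seat's `BoundaryDecayBall.lean`.
-/

noncomputable section

open MeasureTheory Filter Function ProbabilityTheory Real SimpleGraph
open scoped NNReal
open Literature.Probability.LatticeModels
open Literature.MathematicalPhysics.QuantumLattice
open Literature.MathematicalPhysics.QuantumFieldTheory hiding ZdEdge Site
open Literature.MathematicalPhysics.QuantumFieldTheory (walkEdges card_walkEdges_le_length)

namespace Summit.Ventures.YMGap.RobustBall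

variable {d N : ℕ}

/-- The bookkeeping step: `2√N · (|c| √N |γ|) · #(links of γ) · r ≤ 2N|c| · |γ|² · r` for `r ≥ 0`. [folklore] -/
theorem loop_constant_le (c : ℝ) {x : Literature.Probability.LatticeModels.Site d} (w : (zdGraph d).Walk x x) {r : ℝ} (hr : 0 ≤ r) :
    2 * Real.sqrt N * ((⟨|c| * Real.sqrt N * w.length, by positivity⟩ : ℝ≥0) : ℝ) * (walkEdges w).card * r ≤
      2 * N * |c| * (w.length : ℝ) ^ 2 * r := by
  show 2 * Real.sqrt N * (|c| * Real.sqrt N * w.length) * (walkEdges w).card * r ≤ _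
  have hcard : ((walkEdges w).card : ℝ) ≤ w.length := by exact_mod_cast card_walkEdges_le_length w
  have hsq : Real.sqrt N * Real.sqrt N = N := Real.mul_self_sqrt (Nat.cast_nonneg N)
  have h0 : 0 ≤ 2 * Real.sqrt N * (|c| * Real.sqrt N * w.length) * r := by positivity
  calc 2 * Real.sqrt N * (|c| * Real.sqrt N * w.length) * (walkEdges w).card * r
      = (2 * Real.sqrt N * (|c| * Real.sqrt N * w.length) * r) * (walkEdges w).card := by ring
    _ ≤ (2 * Real.sqrt N * (|c| * Real.sqrt N * w.length) * r) * w.length := mul_le_mul_of_nonneg_left hcard h0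
    _ = 2 * (Real.sqrt N * Real.sqrt N) * |c| * (w.length : ℝ) ^ 2 * r := by ring
    _ = 2 * N * |c| * (w.length : ℝ) ^ 2 * r := by rw [hsq]

/-- ★ **WILSON LOOPS ON THE TIER-1 BALL, `SU(2)`, every `d ≥ 1`, HYPOTHESIS-FREE** (sharp pair; Wilson units, 't Hooft `β_W/4`): if
`2(d−1)|β_W| e^{ε₀} + e^{ε₀/2} √(2/3) ε₁ ≤ ρ < 1` then for every member `(W, supp)` of `MemBallZd ε₀ ε₁ R`, every DLR state `μ`, every finite
volume `Λ`, EVERY boundary field `η`, every coupling `c` and every closed lattice walk `γ` whose links are at base-point depth `≥ D` in `Λ`: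
`|∫ c W_γ dγ^W_Λ(· | η) − ∫ c W_γ dμ| ≤ 4 · |c| · |γ|² · max(ρ,½)^{⌊D / max(1,R)⌋}`. [folklore] -/
theorem abs_boundary_loop_sub_le_of_memBallZd_su2 (hd : 1 ≤ d) {βW ε₀ ε₁ ρ R : ℝ}
    (hρ : 2 * ((d : ℝ) - 1) * |βW| * exp ε₀ + exp (ε₀ / 2) * Real.sqrt (2 / 3) * ε₁ ≤ ρ) (hρ1 : ρ < 1)
    {W : Potential (ZdEdge d) (SUN 2)} {supp : Finset (ZdEdge d) → Finset (Finset (ZdEdge d))} (hmem : MemBallZd ε₀ ε₁ R W supp)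
    {μ : Measure (LGConfig d (SUN 2))} (hμ : μ ∈ perturbedGibbsMeasures (d := d) (fundamentalRep (Fin 2)) ((2 : ℕ) * (βW / 4)) W supp)
    (Λ : Finset (ZdEdge d)) (η : LGConfig d (SUN 2)) (c : ℝ) {x : Literature.Probability.LatticeModels.Site d}
    (w : (zdGraph d).Walk x x) {D : ℝ} (hD : ∀ y ∈ walkEdges w, ∀ z, z ∉ Λ → D ≤ ‖y.1 - z.1‖) :
    |(∫ U, loopTerm 2 c w U ∂(perturbedYM (d := d) (fundamentalRep (Fin 2)) ((2 : ℕ) * (βW / 4)) W supp Λ η)) - ∫ U, loopTerm 2 c w U ∂μ| ≤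
      4 * |c| * (w.length : ℝ) ^ 2 * (max ρ (1 / 2)) ^ ⌊D / max 1 R⌋₊ := by
  have h := su2_abs_boundary_sub_integral_le hd hρ hρ1 hmem hμ Λ η (isLipschitzCylinder_loopTerm (N := 2) c w) hD
  have hr : 0 ≤ (max ρ (1 / 2)) ^ ⌊D / max 1 R⌋₊ := pow_nonneg (le_max_of_le_right (by norm_num)) _
  refine (h.trans (loop_constant_le (N := 2) c w hr)).trans (le_of_eq ?_)
  push_cast
  ring

/-- ★★ **THE WILSON POINT, `SU(2)` on `ℤ⁴`, `0 ≤ β_W ≤ 1/12`** (tree coupling `β_W/2`): for EVERY DLR state `μ`, every finite volume `Λ`, EVERY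
boundary field `η`, and every closed lattice walk `γ` whose links are at depth `≥ D` in `Λ`:
`|⟨W_γ⟩_{Λ,η} − ⟨W_γ⟩_μ| ≤ 4 · |γ|² · (1/2)^{⌊D⌋}` (`W_γ = Re tr U_γ / 2`). [folklore] -/
theorem su2_wilson_loop_boundary_upTo_oneTwelfth {βW : ℝ} (h0 : 0 ≤ βW) (h : βW ≤ 1 / 12)
    {μ : Measure (LGConfig 4 (SUN 2))} (hμ : μ ∈ ymGibbsMeasures (d := 4) (fundamentalRep (Fin 2)) (βW / 2))
    (Λ : Finset (ZdEdge 4)) (η : LGConfig 4 (SUN 2)) {x : Literature.Probability.LatticeModels.Site 4} (w : (zdGraph 4).Walk x x)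
    {D : ℝ} (hD : ∀ y ∈ walkEdges w, ∀ z, z ∉ Λ → D ≤ ‖y.1 - z.1‖) :
    |(∫ U, loopTerm 2 1 w U ∂(ymSpecification (d := 4) (fundamentalRep (Fin 2)) (βW / 2) Λ η)) - ∫ U, loopTerm 2 1 w U ∂μ| ≤
      4 * (w.length : ℝ) ^ 2 * (1 / 2 : ℝ) ^ ⌊D⌋₊ := by
  have h1 := su2_wilson_boundary_upTo_oneTwelfth h0 h hμ Λ η (isLipschitzCylinder_loopTerm (N := 2) 1 w) hD
  have hr : 0 ≤ (1 / 2 : ℝ) ^ ⌊D⌋₊ := pow_nonneg (by norm_num) _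
  refine (h1.trans (loop_constant_le (N := 2) 1 w hr)).trans (le_of_eq ?_)
  rw [abs_one]
  push_cast
  ring

/-- **Boxes**: `SU(2)` on `ℤ⁴`, `0 ≤ β_W ≤ 1/12`, a loop with links based in `[−m, m]⁴`, the box `[−n, n]⁴` with ANY boundary field:
`|⟨W_γ⟩_{box n,η} − ⟨W_γ⟩_μ| ≤ 4 · |γ|² · (1/2)^{n − m}`. [folklore] -/
theorem su2_wilson_loop_box_upTo_oneTwelfth {βW : ℝ} (h0 : 0 ≤ βW) (h : βW ≤ 1 / 12)
    {μ : Measure (LGConfig 4 (SUN 2))} (hμ : μ ∈ ymGibbsMeasures (d := 4) (fundamentalRep (Fin 2)) (βW / 2))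
    {m : ℕ} (n : ℕ) (η : LGConfig 4 (SUN 2)) {x : Literature.Probability.LatticeModels.Site 4} (w : (zdGraph 4).Walk x x)
    (hw : walkEdges w ⊆ boxLinks 4 m) :
    |(∫ U, loopTerm 2 1 w U ∂(ymSpecification (d := 4) (fundamentalRep (Fin 2)) (βW / 2) (boxLinks 4 n) η)) - ∫ U, loopTerm 2 1 w U ∂μ| ≤
      4 * (w.length : ℝ) ^ 2 * (1 / 2 : ℝ) ^ (n - m) := by
  have key := su2_wilson_loop_boundary_upTo_oneTwelfth h0 h hμ (boxLinks 4 n) η w (D := (n : ℝ) - m) fun y hy z hz => by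
    have hy' := hw hy
    rw [mem_boxLinks, mem_siteBox_iff_norm] at hy' hz
    have hz' : (n : ℝ) < ‖z.1‖ := lt_of_not_ge hz
    have h' := norm_sub_norm_le z.1 y.1
    rw [norm_sub_rev] at h'
    linarith
  have hfloor : ⌊(n : ℝ) - m⌋₊ = n - m := by
    rcases le_or_gt m n with h' | h'
    · rw [← Nat.cast_sub h', Nat.floor_natCast]
    · rw [Nat.floor_of_nonpos (by linarith [(Nat.cast_lt (α := ℝ)).2 h']), eq_comm]
      omega
  rwa [hfloor] at key

/-- ★ **EVERY `N ≥ 2`, EVERY `d ≥ 1`, WILSON, Bakry–Émery window** (`2(d−1)|β| < 1/2`, 't Hooft `β`, tree coupling `Nβ`; `ρ ≥ 6(d−1)|β|/(1/2 − 2(d−1)|β|)`,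
`ρ < 1`, `ρ' = max(ρ,½)`): for every DLR state, every volume, EVERY boundary field and every closed walk `γ` at depth `≥ D`:
`|⟨W_γ⟩_{Λ,η} − ⟨W_γ⟩_μ| ≤ 2N · |γ|² · ρ'^{⌊D⌋}` (`W_γ = Re tr U_γ / N`). [folklore] -/
theorem suN_wilson_loop_boundary_bakryEmery (hd : 1 ≤ d) (hN : 2 ≤ N) {β ρ : ℝ} (hb : |β| * (2 * ((d : ℝ) - 1)) < 1 / 2)
    (hρ : 6 * ((d : ℝ) - 1) * |β| / (1 / 2 - |β| * (2 * ((d : ℝ) - 1))) ≤ ρ) (hρ1 : ρ < 1)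
    {μ : Measure (LGConfig d (SUN N))} (hμ : μ ∈ ymGibbsMeasures (d := d) (fundamentalRep (Fin N)) (N * β))
    (Λ : Finset (ZdEdge d)) (η : LGConfig d (SUN N)) {x : Literature.Probability.LatticeModels.Site d} (w : (zdGraph d).Walk x x)
    {D : ℝ} (hD : ∀ y ∈ walkEdges w, ∀ z, z ∉ Λ → D ≤ ‖y.1 - z.1‖) :
    |(∫ U, loopTerm N 1 w U ∂(ymSpecification (d := d) (fundamentalRep (Fin N)) (N * β) Λ η)) - ∫ U, loopTerm N 1 w U ∂μ| ≤
      2 * N * (w.length : ℝ) ^ 2 * (max ρ (1 / 2)) ^ ⌊D⌋₊ := by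
  classical
  set supp : Finset (ZdEdge d) → Finset (Finset (ZdEdge d)) := fun _ => ∅ with hsupp
  have hmem : MemBallZd (N := N) (0 : ℝ) 0 0 (0 : Potential (ZdEdge d) (SUN N)) supp :=
    memBallZd_zero le_rfl le_rfl fun _ _ h => by simp [hsupp] at h
  have hμ' : μ ∈ perturbedGibbsMeasures (d := d) (fundamentalRep (Fin N)) (N * β) 0 supp := by
    rwa [perturbedGibbsMeasures_zero]
  have hρ' : 6 * ((d : ℝ) - 1) * |β| * exp 0 / (1 / 2 - |β| * (2 * ((d : ℝ) - 1))) +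
      exp (0 / 2) * 0 / Real.sqrt ((N : ℝ) * (1 / 2 - |β| * (2 * ((d : ℝ) - 1)))) ≤ ρ := by
    rw [Real.exp_zero, mul_one, mul_zero, zero_div, add_zero]
    exact hρ
  have key := suN_abs_boundary_sub_integral_le_bakryEmery hd hN (ε₀ := 0) (ε₁ := 0) (R := 0) hb hρ' hρ1 hmem hμ' Λ η
    (isLipschitzCylinder_loopTerm (N := N) 1 w) hD
  rw [perturbedYM_zero, max_eq_left (zero_le_one : (0 : ℝ) ≤ 1), div_one] at key
  have hr : 0 ≤ (max ρ (1 / 2)) ^ ⌊D⌋₊ := pow_nonneg (le_max_of_le_right (by norm_num)) _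
  refine (key.trans (loop_constant_le (N := N) 1 w hr)).trans (le_of_eq ?_)
  rw [abs_one]
  ring

end Summit.Ventures.YMGap.RobustBall

end
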